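import Literature.Computability.AlgebraicComplexity.DegenerationSpectralMonotone
import Mathlib.Algebra.Polynomial.Degree.TrailingDegree
import Mathlib.Algebra.Polynomial.Eval.Degree
import Mathlib.RingTheory.Localization.Integral
import Mathlib.RingTheory.Localization.FractionRing
import HarnessLib

/-!
# Bootstrapping a degeneration over `K[λ]` down to `K` (Alman–Li 2026, proof of Cor. 5.1)

Topic `Literature/Computability/AlgebraicComplexity` (family `MatrixMultiplication`). Source: J. Alman,
B. Li, *Asymptotic Rank Speedup Theorems, Revisited*, arXiv:2605.21738 (2026), §5.2, proof of
Corollary 5.1 (held text `paper:arxiv-2605.21738`, p0012 L64 – p0013 L12).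

## The printed argument (p0012–p0013)

"… we obtain a degeneration of `𝔽(λ)`-tensors `T_λ ⊕ T'_λ ⊴ S`, say this degeneration is
parametrized by another symbol `ε`. We may scale by `λ` and `ε`, to assume that the degeneration is
given by `A_{λ,ε}, B_{λ,ε}` and `C_{λ,ε}`, and `T'_λ = T' + O(λ)`, such that
`(T ⊕ T') + O(λ) + O_λ(ε) = (A_{λ,ε} ⊗ B_{λ,ε} ⊗ C_{λ,ε}) S`. The notation means that `O(λ)` term
is purely a `λ`-high order term tensor over `𝔽`, but `O_λ(ε)` term is a `ε`-high order term tensor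
that can also contain `λ`. One can again reduce to the regular definition of degeneration by
substituting `ε` by a large enough power `ε = λ^k`, then the whole restriction again becomes
`(T ⊕ T') + O(λ) = (A_{λ,λ^k} ⊗ B_{λ,λ^k} ⊗ C_{λ,λ^k}) S`. This concludes the degeneration."

## The form proved here (the substitution step, in the tree's coordinates)

The tree's degenerations are `AlgDegeneratesTo s t` over ANY commutative semiring of scalars
(`DegenerationSpectralMonotone.lean`, BCS (15.19): polynomial matrices in `ε` with
`(A ⊗ B ⊗ C) s = ε^h t + O(ε^{h+1})`). Taking the scalars to be `K[λ]` themselves gives the printed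
two-parameter situation after denominators are cleared ("we may scale by `λ`"): a degeneration over
`K[λ]` from the constant tensor `R` to a `K[λ]`-tensor `D · P`, where `P = λ^{h₀} T + O(λ^{h₀+1})`
carries the target `T` as its lowest `λ`-order term and `D ≠ 0` is the cleared denominator.
`AlmanLi2026.algDegeneratesTo_of_polynomialFamily` performs the printed substitution `ε := λ^N`
(`N = v + h₀ + 1`, `v` the `λ`-adic order of `D`): the `λ`-coefficients of
`(A_{λ,λ^N} ⊗ B_{λ,λ^N} ⊗ C_{λ,λ^N}) R` vanish below degree `N h + v + h₀` and equal `d₀ · T` there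
(`d₀ ≠ 0` the trailing coefficient of `D`), so `R ⊵ d₀ T ≥ T` over `K`.  This is the reusable
"bootstrapping" step by which field-level speedup theorems over `L = K(λ)` (e.g. the files
`AlmanLi2026FreeLunchSpeedup`, `AlmanLi2026OneSliceRankCount`) yield degenerations over `K`.
No new definitions, no named facts.

APPEND 1 adds the other half of the printed "we may scale by `λ`": **clearing denominators**
(`AlmanLi2026.exists_algDegeneratesTo_polynomial_of_isFractionRing`: a degeneration over a fraction
field `L ⊇ K[λ]` — e.g. `RatFunc K` — between the images of `R` and of a `K[λ]`-tensor `P` yields,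
for some `D ≠ 0` in `K[λ]`, a degeneration over the RING `K[λ]` from `R` to `D · P`, by
`IsLocalization.integerNormalization` entrywise and one common denominator per matrix), and the
combination `AlmanLi2026.algDegeneratesTo_of_isFractionRing` (degeneration over `L` onto the image of
`P = λ^{h₀} T + O(λ^{h₀+1})` ⟹ `T ⊴ R` over `K`) — the full bootstrapping of Cor. 5.1 in the form
used to pull the FIELD-level speedup theorems over `K(λ)` down to `K`.

## References

* J. Alman, B. Li, *Asymptotic Rank Speedup Theorems, Revisited*, arXiv:2605.21738 (2026), proof of
  Cor. 5.1 (p0012–p0013). [AlmanLi2026]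
* P. Bürgisser, M. Clausen, M. A. Shokrollahi, *Algebraic Complexity Theory* (1997), (15.19)–(15.20)
  (degenerations of order `h`). [BurgisserClausenShokrollahi1997]
-/

noncomputable section

open scoped BigOperators Polynomial
open Polynomial

namespace Literature.Computability.AlgebraicComplexity

universe u

variable {K : Type u}
variable {ι κ μ ι' κ' μ' : Type*}

namespace AlmanLi2026

/-! ## `λ`-coefficients of `D · P` when `P = λ^{h₀} T + O(λ^{h₀+1})` -/

/-- If `P ≡ t·λ^{h₀} (mod λ^{h₀+1})` coefficientwise below `h₀`, then `D·P` has vanishing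
coefficients below `v + h₀` and coefficient `d₀ t` there, `v`/`d₀` the trailing degree/coefficient of
`D`. [folklore] -/
private theorem coeff_mul_of_lowest [CommSemiring K] {D P : K[X]} {t : K} {h₀ : ℕ}
    (hP : ∀ j ≤ h₀, P.coeff j = if j = h₀ then t else 0) {i : ℕ}
    (hi : i ≤ D.natTrailingDegree + h₀) :
    (D * P).coeff i = if i = D.natTrailingDegree + h₀ then D.trailingCoeff * t else 0 := by
  rw [Polynomial.coeff_mul]
  by_cases hieq : i = D.natTrailingDegree + h₀
  · rw [if_pos hieq, Finset.sum_eq_single (D.natTrailingDegree, h₀)]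
    · rw [hP h₀ le_rfl, if_pos rfl]
      rfl
    · rintro ⟨x₁, x₂⟩ hx hne
      rw [Finset.mem_antidiagonal] at hx
      by_cases hx₁ : x₁ < D.natTrailingDegree
      · rw [Polynomial.coeff_eq_zero_of_lt_natTrailingDegree hx₁, zero_mul]
      · have hx₂ : x₂ ≤ h₀ := by simp only at hx; omega
        rw [hP x₂ hx₂]
        have : x₂ ≠ h₀ := by
          rintro rfl
          apply hne
          simp only at hx
          have hx₁' : x₁ = D.natTrailingDegree := by omega
          rw [hx₁']
        rw [if_neg this, mul_zero]
    · intro h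
      exact absurd (Finset.mem_antidiagonal.2 hieq.symm) h
  · rw [if_neg hieq]
    refine Finset.sum_eq_zero ?_
    rintro ⟨x₁, x₂⟩ hx
    rw [Finset.mem_antidiagonal] at hx
    by_cases hx₁ : x₁ < D.natTrailingDegree
    · rw [Polynomial.coeff_eq_zero_of_lt_natTrailingDegree hx₁, zero_mul]
    · have hx₂ : x₂ ≤ h₀ := by simp only at hx; omega
      have : x₂ ≠ h₀ := by simp only at hx; omega
      rw [hP x₂ hx₂, if_neg this, mul_zero]

/-! ## `λ`-coefficients after the substitution `ε := λ^N` -/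

/-- For `q ∈ K[λ][ε]` with `ε`-coefficients vanishing below `h`: the `λ`-coefficient of degree
`m < N (h+1)` of `q(ε := λ^N)` is the `λ`-coefficient of degree `m − N h` of the `ε^h`-coefficient
(and `0` if `m < N h`). [folklore] -/
private theorem coeff_eval_X_pow [CommSemiring K] {q : K[X][X]} {h N m : ℕ}
    (hq : ∀ j < h, q.coeff j = 0) (hm : m < N * (h + 1)) :
    (q.eval ((X : K[X]) ^ N)).coeff m = if N * h ≤ m then (q.coeff h).coeff (m - N * h) else 0 := by
  rw [Polynomial.eval_eq_sum_range' (n := max (q.natDegree + 1) (h + 1))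
    (lt_of_lt_of_le (Nat.lt_succ_self _) (le_max_left _ _)), Polynomial.finsetSum_coeff,
    Finset.sum_eq_single h]
  · rw [← pow_mul, Polynomial.coeff_mul_X_pow']
  · intro j hj hjh
    rw [← pow_mul, Polynomial.coeff_mul_X_pow']
    rcases lt_or_gt_of_ne hjh with hlt | hgt
    · rw [hq j hlt, Polynomial.coeff_zero, ite_self]
    · have : ¬N * j ≤ m := by
        intro hle
        have : N * (h + 1) ≤ N * j := Nat.mul_le_mul_left _ hgt
        omega
      rw [if_neg this]
  · intro hnot
    exact absurd (Finset.mem_range.2 (lt_of_lt_of_le (Nat.lt_succ_self h) (le_max_right _ _))) hnot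

/-! ## The bootstrapping step -/

/-- **Alman–Li 2026, proof of Cor. 5.1 — the substitution `ε := λ^N` ("bootstrapping")**, as a
reusable transfer statement in the tree's coordinates: let `R` be a tensor over `K` and `P` a tensor
over `K[λ]` whose `λ`-coefficients below `h₀` vanish and whose `λ^{h₀}`-coefficient is `T`
(`P = λ^{h₀} T + O(λ^{h₀+1})`), and let `D ∈ K[λ]`, `D ≠ 0`. If `D · P` is a degeneration of (the
constant tensor) `R` OVER THE RING `K[λ]` — polynomial matrices in a second variable `ε` with entries
in `K[λ][ε]`, `(A ⊗ B ⊗ C) R = ε^h · D P + O_λ(ε^{h+1})` — then `T` is a degeneration of `R` over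
`K`: substitute `ε := λ^N` with `N` larger than the `λ`-order of `D P`'s lowest term.
[cite: AlmanLi2026, Cor. 5.1 (proof: "substituting ε by a large enough power ε = λ^k")] -/
theorem algDegeneratesTo_of_polynomialFamily [Field K] [Fintype ι] [Fintype κ] [Fintype μ]
    [Fintype ι'] [Fintype κ'] [Fintype μ'] [DecidableEq ι'] [DecidableEq κ'] [DecidableEq μ']
    {R : ι → κ → μ → K} {T : ι' → κ' → μ' → K} {P : ι' → κ' → μ' → K[X]} {D : K[X]} (hD : D ≠ 0)
    {h₀ : ℕ} (hP : ∀ a b c, ∀ j ≤ h₀, (P a b c).coeff j = if j = h₀ then T a b c else 0)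
    (hdeg : AlgDegeneratesTo (fun a b c => Polynomial.C (R a b c)) (fun a b c => D * P a b c)) :
    AlgDegeneratesTo R T := by
  obtain ⟨h, A, B, C, happ⟩ := hdeg
  set v := D.natTrailingDegree with hv
  set d₀ := D.trailingCoeff with hd₀
  have hd₀ne : d₀ ≠ 0 := Polynomial.trailingCoeff_nonzero_iff_nonzero.2 hD
  set N := v + h₀ + 1 with hN
  -- the substituted matrices `A_{λ,λ^N}` etc.
  have hsub : IsApproxRestriction (N * h + (v + h₀)) R (fun a b c => d₀ * T a b c)
      (fun a' a => (A a' a).eval ((X : K[X]) ^ N)) (fun b' b => (B b' b).eval ((X : K[X]) ^ N))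
      (fun c' c => (C c' c).eval ((X : K[X]) ^ N)) := by
    intro a' b' c' m hm
    -- the triple sum is `q(ε := λ^N)` for `q = (A ⊗ B ⊗ C) R ∈ K[λ][ε]`
    have hq : (∑ a, ∑ b, ∑ c, (A a' a).eval ((X : K[X]) ^ N) * (B b' b).eval ((X : K[X]) ^ N) *
        (C c' c).eval ((X : K[X]) ^ N) * Polynomial.C (R a b c)) =
        (∑ a, ∑ b, ∑ c, A a' a * B b' b * C c' c *
          Polynomial.C (Polynomial.C (R a b c))).eval ((X : K[X]) ^ N) := by
      simp only [Polynomial.eval_finsetSum, Polynomial.eval_mul, Polynomial.eval_C]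
    rw [hq, coeff_eval_X_pow (h := h) (fun j hj => by rw [happ a' b' c' j hj.le, if_neg hj.ne])
      (by rw [hN] at hm ⊢; nlinarith [hm])]
    by_cases hle : N * h ≤ m
    · rw [if_pos hle, happ a' b' c' h le_rfl, if_pos rfl,
        coeff_mul_of_lowest (hP a' b' c') (by omega)]
      by_cases hmeq : m = N * h + (v + h₀)
      · rw [if_pos hmeq, if_pos (by omega)]
      · rw [if_neg hmeq, if_neg (by omega)]
    · rw [if_neg hle, if_neg (by omega)]
  -- `R ⊵ d₀ T ≥ T`
  have hdeg' : AlgDegeneratesTo R (fun a b c => d₀ * T a b c) := ⟨_, _, _, _, hsub⟩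
  refine hdeg'.trans_restrictsTo ?_
  refine ⟨fun a' a => if a = a' then 1 else 0, fun b' b => if b = b' then 1 else 0,
    fun c' c => if c = c' then d₀⁻¹ else 0, fun a' b' c' => ?_⟩
  rw [Finset.sum_eq_single a' (fun a _ ha => by simp [ha]) (by simp),
    Finset.sum_eq_single b' (fun b _ hb => by simp [hb]) (by simp),
    Finset.sum_eq_single c' (fun c _ hc => by simp [hc]) (by simp)]
  simp only [if_true]
  field_simp

/-! ## Clearing denominators (APPEND 1): from a fraction field `L ⊇ K[λ]` down to `K[λ]` -/

section ClearDenominators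

variable [Field K] {L : Type*} [CommRing L] [Algebra K[X] L] [IsFractionRing K[X] L]

/-- A finite family of polynomials over the fraction field `L` of `K[λ]` has a common denominator:
`b ≠ 0` in `K[λ]` and polynomials over `K[λ]` mapping to `b · F e` ("we may scale by `λ`").
[cite: AlmanLi2026, Cor. 5.1 (proof)] -/
private theorem exists_common_denominator_family {E : Type*} [Fintype E] [DecidableEq E] (F : E → L[X]) :
    ∃ b : K[X], b ≠ 0 ∧ ∃ G : E → K[X][X], ∀ e,
      (G e).map (algebraMap K[X] L) = Polynomial.C (algebraMap K[X] L b) * F e := by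
  choose b hbM hb using
    fun e => IsLocalization.integerNormalization_spec (nonZeroDivisors K[X]) (F e)
  have hb' : ∀ e, (IsLocalization.integerNormalization (nonZeroDivisors K[X]) (F e)).map
      (algebraMap K[X] L) = Polynomial.C (algebraMap K[X] L (b e)) * F e := fun e => by
    rw [hb e, ← Polynomial.smul_eq_C_mul, algebraMap_smul]
  refine ⟨∏ e, b e, Finset.prod_ne_zero_iff.2 fun e _ => nonZeroDivisors.ne_zero (hbM e),
    fun e => Polynomial.C (∏ e' ∈ Finset.univ.erase e, b e') *
      IsLocalization.integerNormalization (nonZeroDivisors K[X]) (F e), fun e => ?_⟩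
  rw [Polynomial.map_mul, Polynomial.map_C, hb' e, ← mul_assoc, ← Polynomial.C_mul, ← map_mul,
    Finset.prod_erase_mul _ _ (Finset.mem_univ e)]

/-- **Alman–Li 2026, proof of Cor. 5.1 — "we may scale by `λ`" (clearing denominators).** A
degeneration over a fraction field `L` of `K[λ]` (e.g. `RatFunc K`) from the image of a `K`-tensor
`R` to the image of a `K[λ]`-tensor `P` gives, for some nonzero `D ∈ K[λ]`, a degeneration over the
ring `K[λ]` from `R` to `D · P` (same order; the three matrices multiplied through by common
denominators). [cite: AlmanLi2026, Cor. 5.1 (proof)] -/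
theorem exists_algDegeneratesTo_polynomial_of_isFractionRing [Fintype ι] [Fintype κ] [Fintype μ]
    [Fintype ι'] [Fintype κ'] [Fintype μ'] [DecidableEq ι] [DecidableEq κ] [DecidableEq μ]
    [DecidableEq ι'] [DecidableEq κ'] [DecidableEq μ']
    {R : ι → κ → μ → K} {P : ι' → κ' → μ' → K[X]}
    (hdeg : AlgDegeneratesTo (fun a b c => algebraMap K[X] L (Polynomial.C (R a b c)))
      (fun a b c => algebraMap K[X] L (P a b c))) :
    ∃ D : K[X], D ≠ 0 ∧
      AlgDegeneratesTo (fun a b c => Polynomial.C (R a b c)) (fun a b c => D * P a b c) := by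
  obtain ⟨h, A, B, C, happ⟩ := hdeg
  obtain ⟨bA, hbA, A', hA'⟩ := exists_common_denominator_family (K := K) (fun e : ι' × ι => A e.1 e.2)
  obtain ⟨bB, hbB, B', hB'⟩ := exists_common_denominator_family (K := K) (fun e : κ' × κ => B e.1 e.2)
  obtain ⟨bC, hbC, C', hC'⟩ := exists_common_denominator_family (K := K) (fun e : μ' × μ => C e.1 e.2)
  refine ⟨bA * bB * bC, mul_ne_zero (mul_ne_zero hbA hbB) hbC, h, fun a' a => A' (a', a),
    fun b' b => B' (b', b), fun c' c => C' (c', c), fun a' b' c' j hj => ?_⟩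
  set φ := algebraMap K[X] L with hφ
  -- map the candidate identity into `L[ε]`, where it is `φ(bA bB bC) ·` the given one
  have hmap : (∑ a, ∑ b, ∑ c, A' (a', a) * B' (b', b) * C' (c', c) *
      Polynomial.C (Polynomial.C (R a b c))).map φ =
      Polynomial.C (φ (bA * bB * bC)) * ∑ a, ∑ b, ∑ c, A a' a * B b' b * C c' c *
        Polynomial.C (φ (Polynomial.C (R a b c))) := by
    simp only [Polynomial.map_sum, Polynomial.map_mul, Polynomial.map_C, hA', hB', hC', map_mul,
      Finset.mul_sum]
    refine Finset.sum_congr rfl fun a _ => Finset.sum_congr rfl fun b _ =>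
      Finset.sum_congr rfl fun c _ => ?_
    ring
  apply IsFractionRing.injective K[X] L
  rw [← hφ, ← Polynomial.coeff_map, hmap, Polynomial.coeff_C_mul, happ a' b' c' j hj]
  by_cases hjh : j = h
  · rw [if_pos hjh, if_pos hjh]
    simp only [map_mul]
  · rw [if_neg hjh, if_neg hjh, mul_zero, map_zero]

/-- **Alman–Li 2026, Cor. 5.1 — the full bootstrapping**: a degeneration over a fraction field
`L ⊇ K[λ]` from (the image of) a `K`-tensor `R` onto (the image of) `P = λ^{h₀} T + O(λ^{h₀+1})`
yields `T ⊴ R` over `K` (clear denominators, then substitute `ε := λ^N`).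
[cite: AlmanLi2026, Cor. 5.1 (proof)] -/
theorem algDegeneratesTo_of_isFractionRing [Fintype ι] [Fintype κ] [Fintype μ] [Fintype ι']
    [Fintype κ'] [Fintype μ'] [DecidableEq ι] [DecidableEq κ] [DecidableEq μ] [DecidableEq ι']
    [DecidableEq κ'] [DecidableEq μ']
    {R : ι → κ → μ → K} {T : ι' → κ' → μ' → K} {P : ι' → κ' → μ' → K[X]} {h₀ : ℕ}
    (hP : ∀ a b c, ∀ j ≤ h₀, (P a b c).coeff j = if j = h₀ then T a b c else 0)
    (hdeg : AlgDegeneratesTo (fun a b c => algebraMap K[X] L (Polynomial.C (R a b c)))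
      (fun a b c => algebraMap K[X] L (P a b c))) :
    AlgDegeneratesTo R T := by
  obtain ⟨D, hD, hdeg'⟩ := exists_algDegeneratesTo_polynomial_of_isFractionRing hdeg
  exact algDegeneratesTo_of_polynomialFamily hD hP hdeg'

end ClearDenominators

end AlmanLi2026

end Literature.Computability.AlgebraicComplexity
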